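import Literature.AlgebraicGeometry.Motives.AbelianVarietyPermutationPowerReciprocity
import Literature.AlgebraicGeometry.Motives.AbelianVarietyEquivariantTateHomSymmetry
import Literature.RepresentationTheory.FiniteGroups.PermutationCharacter
import HarnessLib

/-!
# Equivariant homomorphisms of Tate modules of permutation powers:
# `rk Hom_{ℤ_ℓ[G]}(T_ℓ A^S, T_ℓ B^T) = |G\(S × T)| · 4 dim A dim B` and the `ℓ`-adic Frobenius reciprocity
# `rk Hom_{ℤ_ℓ[G]}(T_ℓ X, T_ℓ A^{G/H}) = 4 · dim A · dim B_H(X)`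

For a finite group `G`, finite `G`-sets `S`, `T`, abelian varieties `A`, `B`, `X` over a field `K` and a prime `ℓ` invertible
in `K`, the `ℓ`-adic inner product `|G| · rk_{ℤ_ℓ} Hom_{ℤ_ℓ[G]}(T_ℓ X, T_ℓ Y) = Σ_g χ_Y(g) χ_X(g⁻¹)`
(`Motives/AbelianVarietyEquivariantHomCharacterBound`) evaluated on the PERMUTATION CHARACTERS `χ_{A^S}(g) = |S^g| · 2 dim A`
(`Motives/AbelianVarietyPermutationPowerCharacter`) gives:

* §1 `|(S × T)^g| = |S^g| · |T^g|` (Serre Ex. 2.6 (b): the character of `X × Y` is `χ_X χ_Y`) and, by Burnside,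
  **`rk_{ℤ_ℓ} Hom_{ℤ_ℓ[G]}(T_ℓ A^S, T_ℓ B^T) = |G\(S × T)| · 4 dim A dim B`** (`finrank_equivariantTateHom_permPower_eq`) — against
  the exact algebraic count `rk_ℤ Hom_G(A^S, B^T) = |G\(S × T)| · rk_ℤ Hom(A, B)` of `Motives/AbelianVarietyPermutationPowerHom`,
  the factor `rk Hom(A, B) ≤ 4 dim A dim B` being Mumford's §19 Cor. 1;
* §2 the invariant maps: **`rk_{ℤ_ℓ} {f : T_ℓ A^S → T_ℓ Y | f ∘ T_ℓ ρ(g) = f} = 4 · |G\S| · dim A · dim Y`** and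
  **`rk_{ℤ_ℓ} {f : T_ℓ X → T_ℓ B^T | T_ℓ ρ(g) ∘ f = f} = 4 · dim X · |G\T| · dim B`** (`Motives/AbelianVarietyInvariantHomRank`
  with `dim B_G(A^S) = |G\S| dim A`);
* §3 **`ℓ`-adic Frobenius reciprocity**: for a TRANSITIVE `G`-set `T ∋ t₀` with stabiliser `H` (`N_H = Σ_{h ∈ H} ρ'(h)` acting
  on `X`, `B_H(X) = Im N_H`), `|H| · |T^g| = m_H(g) = |{x : x⁻¹ g x ∈ H}|` (marks; the tree's
  `indClassFun_one_eq_natCard_fixedBy_of_stabilizer_eq` and `natCard_mul_indClassFun_one_apply`), and Frobenius reciprocity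
  in counting form (`card_smul_sum_subgroup_eq_sum_card_conj_smul`: `|G| Σ_{h ∈ H} f(h) = Σ_g m_H(g) f(g)` for a class function
  `f`) applied to `g ↦ χ_X(g⁻¹)` give **`Σ_g |T^g| · χ_X(g⁻¹) = |G| · 2 dim B_H(X)`** (`sum_ncard_fixedBy_mul_trace_inv_eq`) and
  **`rk_{ℤ_ℓ} Hom_{ℤ_ℓ[G]}(T_ℓ X, T_ℓ A^T) = 4 · dim A · dim B_H(X)`** (`finrank_equivariantTateHom_permPower_target_eq`),
  `= rk Hom_{ℤ_ℓ[G]}(T_ℓ A^T, T_ℓ X)` (symmetry, `Motives/AbelianVarietyEquivariantTateHomSymmetry`); hence the Hom-side bound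
  `rk_ℤ Hom_G(X, A^{G/H}) ≤ 4 dim B_H(X) dim A` of `Motives/AbelianVarietyPermutationPowerReciprocity` IS the `ℓ`-adic rank
  (`finrank_equivariantHom_permPower_target_le_finrank_equivariantTateHom`: Mumford §19 Thm. 3 restricted to `Hom_G`).

Everything is a theorem (no definitions); `χ_ℓ` lives in `ℤ_ℓ`; no Tate conjecture is used or asserted.

## References

* [SerreLinearRepresentations1977] J.-P. Serre, *Linear Representations of Finite Groups*, GTM 42 (1977): §2.3 Ex. 2.6 (b)
  (character of the permutation representation on `X × X`), §7.2 Thm. 13 (Frobenius reciprocity) and the formula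
  `⟨φ, ψ⟩ = dim Hom_G` (§7.2), §7.3 Prop. 22.  Held: `book:serre1977-linear-representations-finite-groups`, pp. 20, 51–53.
* [Isaacs1976] I. M. Isaacs, *Character Theory of Finite Groups* (1976), Lemma 5.14, Cor. 5.15 (Burnside), Thm. 5.18 (p. 68:
  `(1_H)^G` is the permutation character on the cosets of `H`).
* [MumfordAV1970] D. Mumford, *Abelian Varieties* (1970), §19 Thm. 3 and Cor. 1 (pp. 176–178), Thm. 4 (p. 180).
* [KaniRosen1989] E. Kani, M. Rosen, *Idempotent relations and factors of Jacobians*, Math. Ann. 284 (1989), §3 Thm. B.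
* [DokchitserEtAl2022] V. Dokchitser, H. Green, A. Konstantinou, A. Morgan, *Parity of ranks of Jacobians of curves*,
  arXiv:2211.06357, §3 and proof of Thm. 8.4 (`Hom_G(Ind_H^G ρ, V) ≃ Hom_H(ρ, V)` with `V = H¹_ℓ`).
-/

noncomputable section

open CategoryTheory CategoryTheory.Limits MulAction
open Literature.RepresentationTheory.FiniteGroups
open Literature.NumberTheory.DiophantineGeometry

universe u

namespace Literature.AlgebraicGeometry.Motives

namespace AbelianVariety

variable {K : Type u} [Field K] (ℓ : ℕ) [Fact ℓ.Prime]

/-! ## §1 `rk Hom_{ℤ_ℓ[G]}(T_ℓ A^S, T_ℓ B^T) = |G\(S × T)| · 4 dim A dim B` -/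

section TwoPowers

variable {A B : AbelianVariety K} {S : Type} [Fintype S] (b : Bicone (fun _ : S ↦ A))
  {T : Type} [Fintype T] (c : Bicone (fun _ : T ↦ B))
  {G : Type} [Group G] [Fintype G] [MulAction G S] [MulAction G T] (ρ : G →* End b.pt) (ρc : G →* End c.pt)

omit [Fintype S] [Fintype T] [Fintype G] in
/-- **`|(S × T)^g| = |S^g| · |T^g|`** for the diagonal action `g (s, t) = (g s, g t)`: the fixed points of `g` on `S × T` are
the pairs of fixed points — the permutation character of `X × X` is `χ²` (Serre Ex. 2.6 (b)), of `X × Y` is `χ_X χ_Y`.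
[cite: SerreLinearRepresentations1977, §2.3 Ex. 2.6 (b)] -/
theorem ncard_fixedBy_prod (g : G) :
    (fixedBy (S × T) g).ncard = (fixedBy S g).ncard * (fixedBy T g).ncard := by
  rw [← Set.ncard_prod]
  congr 1
  ext ⟨s, t⟩
  simp [MulAction.mem_fixedBy, Prod.ext_iff]

/-- **`rk_{ℤ_ℓ} Hom_{ℤ_ℓ[G]}(T_ℓ A^S, T_ℓ B^T) = |G\(S × T)| · 4 · dim A · dim B`** for the permutation actions on two powers over
finite `G`-sets (`G` finite, `ℓ` invertible in `K`): `|G| · rk = Σ_g χ_{B^T}(g) χ_{A^S}(g⁻¹) = 4 dim A dim B · Σ_g |S^g| |T^g| =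
4 dim A dim B · |G\(S × T)| · |G|` (`S^{g⁻¹} = S^g`, Burnside on `S × T`).  The algebraic count is
`rk_ℤ Hom_G(A^S, B^T) = |G\(S × T)| · rk_ℤ Hom(A, B)` (`Motives/AbelianVarietyPermutationPowerHom`), and `rk Hom(A, B) ≤ 4 dim A dim B`.
[cite: SerreLinearRepresentations1977, §2.3 Ex. 2.6 (b) and §7.2 (`⟨φ, ψ⟩ = dim Hom_G`)] [cite: MumfordAV1970, §19 Thm. 3 and Thm. 4 (pp. 176–180)] -/
theorem finrank_equivariantTateHom_permPower_eq (hb : ∑ s, b.π s ≫ b.ι s = 𝟙 b.pt) (hc : ∑ t, c.π t ≫ c.ι t = 𝟙 c.pt)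
    (hρ : ∀ (g : G) (s : S), b.ι s ≫ End.asHom (ρ g) = b.ι (g • s))
    (hρc : ∀ (g : G) (t : T), c.ι t ≫ End.asHom (ρc g) = c.ι (g • t)) (hℓ : (ℓ : K) ≠ 0) :
    Module.finrank ℤ_[ℓ]
        (⨅ g : G, LinearMap.eqLocus (LinearMap.llcomp ℤ_[ℓ] _ _ _ (tateModuleMap ℓ (End.asHom (ρc g))))
          (LinearMap.lcomp ℤ_[ℓ] _ (tateModuleMap ℓ (End.asHom (ρ g)))) :
            Submodule ℤ_[ℓ] (b.pt.tateModule ℓ →ₗ[ℤ_[ℓ]] c.pt.tateModule ℓ)) =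
      Nat.card (Quotient (MulAction.orbitRel G (S × T))) * (4 * A.dim * B.dim) := by
  classical
  have h := card_mul_finrank_equivariantTateHom_eq_sum ℓ ρ ρc hℓ
  simp_rw [trace_tateModuleMap_permAction_eq ℓ c ρc hc hρc hℓ, trace_tateModuleMap_permAction_eq ℓ b ρ hb hρ hℓ,
    MulAction.fixedBy_inv, ← Nat.cast_mul, ← Nat.cast_sum] at h
  -- `Σ_g |T^g| 2 dim B · |S^g| 2 dim A = |G\(S × T)| |G| 4 dim A dim B`
  have hsum : ∑ g : G, (fixedBy T g).ncard * (2 * B.dim) * ((fixedBy S g).ncard * (2 * A.dim)) =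
      Fintype.card G * (Nat.card (Quotient (MulAction.orbitRel G (S × T))) * (4 * A.dim * B.dim)) := by
    have hB := MulAction.sum_card_fixedBy_eq_card_orbits_mul_card_group G (S × T)
    calc ∑ g : G, (fixedBy T g).ncard * (2 * B.dim) * ((fixedBy S g).ncard * (2 * A.dim))
        = (∑ g : G, (fixedBy (S × T) g).ncard) * (4 * A.dim * B.dim) := by
          rw [Finset.sum_mul]
          exact Finset.sum_congr rfl fun g _ ↦ by rw [ncard_fixedBy_prod]; ring
      _ = (∑ g : G, Fintype.card (fixedBy (S × T) g)) * (4 * A.dim * B.dim) := by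
          congr 1
          exact Finset.sum_congr rfl fun g _ ↦ by rw [Set.ncard_eq_toFinset_card', Set.toFinset_card]
      _ = Fintype.card G * (Nat.card (Quotient (MulAction.orbitRel G (S × T))) * (4 * A.dim * B.dim)) := by
          rw [hB, Nat.card_eq_fintype_card]; ring
  rw [hsum] at h
  push_cast at h
  exact_mod_cast mul_left_cancel₀ (Nat.cast_ne_zero.2 (Fintype.card_ne_zero (α := G))) h

/-- **Mumford's bound with operators, permutation powers**: `rk_ℤ Hom_G(A^S, B^T) ≤ |G\(S × T)| · 4 dim A dim B`
(`= rk_{ℤ_ℓ} Hom_{ℤ_ℓ[G]}(T_ℓ A^S, T_ℓ B^T)`), from `rk_ℤ Hom_G(A^S, B^T) = |G\(S × T)| · rk Hom(A, B)` and `Hom(A, B) ⊗ ℤ_ℓ ↪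
Hom(T_ℓ A, T_ℓ B)`. [cite: MumfordAV1970, §19 Thm. 3 and Cor. 1 (pp. 176–178)] [cite: SerreLinearRepresentations1977, §2.3 Ex. 2.6 (b)] -/
theorem finrank_equivariantHom_permPower_le (hb : ∑ s, b.π s ≫ b.ι s = 𝟙 b.pt) (hc : ∑ t, c.π t ≫ c.ι t = 𝟙 c.pt)
    (hρ : ∀ (g : G) (s : S), b.ι s ≫ End.asHom (ρ g) = b.ι (g • s))
    (hρc : ∀ (g : G) (t : T), c.ι t ≫ End.asHom (ρc g) = c.ι (g • t)) :
    Module.finrank ℤ (⨅ g : G, LinearMap.eqLocus (Preadditive.leftComp c.pt (End.asHom (ρ g))).toIntLinearMap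
        (Preadditive.rightComp b.pt (End.asHom (ρc g))).toIntLinearMap : Submodule ℤ (b.pt ⟶ c.pt)) ≤
      Nat.card (Quotient (MulAction.orbitRel G (S × T))) * (4 * A.dim * B.dim) := by
  obtain ⟨l, hlp, hl⟩ := exists_prime_natCast_ne_zero (K := K)
  haveI : Fact l.Prime := ⟨hlp⟩
  rw [← finrank_equivariantTateHom_permPower_eq l b c ρ ρc hb hc hρ hρc hl]
  exact finrank_equivariantHom_le l ρ ρc hl

end TwoPowers

/-! ## §2 Invariant maps out of / into the Tate module of a permutation power -/

section Invariant

variable {A B X Y : AbelianVariety K} {S : Type} [Fintype S] (b : Bicone (fun _ : S ↦ A))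
  {T : Type} [Fintype T] (c : Bicone (fun _ : T ↦ B))
  {G : Type} [Group G] [Fintype G] [MulAction G S] [MulAction G T] (ρ : G →* End b.pt) (ρc : G →* End c.pt)

/-- **`rk_{ℤ_ℓ} {f : T_ℓ A^S → T_ℓ Y | f ∘ T_ℓ ρ(g) = f ∀ g} = 4 · (|G\S| · dim A) · dim Y`** (`ℓ` invertible in `K`, `G` finite):
the source-invariant maps are those out of `(T_ℓ A^S)_G`, of rank `2 dim B_G(A^S) = 2 |G\S| dim A` (Burnside).
[cite: SerreLinearRepresentations1977, §2.3 Ex. 2.6 (a)] [cite: KaniRosen1989, §3 Thm. B] [cite: MumfordAV1970, §19 Thm. 4 (p. 180)] -/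
theorem finrank_tateHom_permPower_source_invariant_eq (hb : ∑ s, b.π s ≫ b.ι s = 𝟙 b.pt)
    (hρ : ∀ (g : G) (s : S), b.ι s ≫ End.asHom (ρ g) = b.ι (g • s)) (hℓ : (ℓ : K) ≠ 0) :
    Module.finrank ℤ_[ℓ]
        (⨅ g : G, LinearMap.eqLocus (LinearMap.lcomp ℤ_[ℓ] (Y.tateModule ℓ) (tateModuleMap ℓ (End.asHom (ρ g))))
          LinearMap.id : Submodule ℤ_[ℓ] (b.pt.tateModule ℓ →ₗ[ℤ_[ℓ]] Y.tateModule ℓ)) =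
      4 * (Nat.card (Quotient (MulAction.orbitRel G S)) * A.dim) * Y.dim := by
  have hNG : End.of (∑ g, End.asHom (ρ g)) = ∑ g, ρ g := rfl
  rw [finrank_tateHom_source_invariant_eq ℓ ρ hNG hℓ, dim_image_normG_permAction_eq b ρ hb hρ hNG]

/-- **`rk_{ℤ_ℓ} {f : T_ℓ X → T_ℓ B^T | T_ℓ ρ(g) ∘ f = f ∀ g} = 4 · dim X · (|G\T| · dim B)`** (`ℓ` invertible in `K`, `G` finite):
the target-invariant maps are those into `(T_ℓ B^T)^G = T_ℓ B_G(B^T)`, of rank `2 |G\T| dim B`.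
[cite: SerreLinearRepresentations1977, §2.3 Ex. 2.6 (a)] [cite: KaniRosen1989, §3 Thm. B] [cite: MumfordAV1970, §19 Thm. 4 (p. 180)] -/
theorem finrank_tateHom_permPower_target_invariant_eq (hc : ∑ t, c.π t ≫ c.ι t = 𝟙 c.pt)
    (hρc : ∀ (g : G) (t : T), c.ι t ≫ End.asHom (ρc g) = c.ι (g • t)) (hℓ : (ℓ : K) ≠ 0) :
    Module.finrank ℤ_[ℓ]
        (⨅ g : G, LinearMap.eqLocus
          (LinearMap.llcomp ℤ_[ℓ] (X.tateModule ℓ) _ _ (tateModuleMap ℓ (End.asHom (ρc g))))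
          LinearMap.id : Submodule ℤ_[ℓ] (X.tateModule ℓ →ₗ[ℤ_[ℓ]] c.pt.tateModule ℓ)) =
      4 * X.dim * (Nat.card (Quotient (MulAction.orbitRel G T)) * B.dim) := by
  have hNG : End.of (∑ g, End.asHom (ρc g)) = ∑ g, ρc g := rfl
  rw [finrank_tateHom_target_invariant_eq ℓ ρc hNG hℓ, dim_image_normG_permAction_eq c ρc hc hρc hNG]

end Invariant

/-! ## §3 `ℓ`-adic Frobenius reciprocity: `rk Hom_{ℤ_ℓ[G]}(T_ℓ X, T_ℓ A^{G/H}) = 4 · dim A · dim B_H(X)` -/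

section Reciprocity

variable {A X : AbelianVariety K} {T : Type} [Fintype T] (b : Bicone (fun _ : T ↦ A))
  {G : Type} [Group G] [Fintype G] [MulAction G T] (ρ : G →* End b.pt) (ρ' : G →* End X) (t₀ : T)

omit [Fintype T] in
/-- **`|H| · |T^g| = m_H(g) = |{x ∈ G : x⁻¹ g x ∈ H}|`** for a transitive `G`-set `T ∋ t₀` with stabiliser `H`: the permutation
character is `(1_H)^G` and the marks clear its denominator (the tree's `indClassFun_one_eq_natCard_fixedBy_of_stabilizer_eq`
and `natCard_mul_indClassFun_one_apply`). [cite: Isaacs1976, Lemma 5.14 and Thm. 5.18 (p. 68)] [cite: SerreLinearRepresentations1977, §3.3 Ex. 2 and Ex. 7.2] -/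
theorem natCard_mul_ncard_fixedBy_eq_natCard_conj_mem [Finite T] [IsPretransitive G T] {H : Subgroup G}
    (hH : stabilizer G t₀ = H) (g : G) :
    Nat.card H * (fixedBy T g).ncard = Nat.card {x : G // x⁻¹ * g * x ∈ H} := by
  have h1 := natCard_mul_indClassFun_one_apply H g
  rw [indClassFun_one_eq_natCard_fixedBy_of_stabilizer_eq t₀ hH] at h1
  dsimp only at h1
  rw [← Nat.card_coe_set_eq]
  exact_mod_cast h1

/-- **Frobenius reciprocity for the `ℓ`-adic character, counting form: `Σ_{g ∈ G} |T^g| · χ_X(g⁻¹) = |G| · 2 · dim B_H(X)`** for a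
transitive `G`-set `T ∋ t₀` with stabiliser `H`, any action `ρ'` of `G` on `X` with `N_H = Σ_{h ∈ H} ρ'(h)`, `B_H(X) = Im N_H`, and
`ℓ` invertible in `K`: `⟨Ind_H^G 1, χ_X⟩_G = ⟨1, Res χ_X⟩_H = |H|⁻¹ Σ_{h ∈ H} χ_X(h) = 2 dim B_H(X)` (`|H| |T^g| = m_H(g)`, `χ_X` a
class function, `Σ_{h ∈ H} χ_X(h⁻¹) = Σ_{h ∈ H} χ_X(h)`). [cite: SerreLinearRepresentations1977, §7.2 Thm. 13]
[cite: DokchitserEtAl2022, §3 and proof of Thm. 8.4] [cite: KaniRosen1989, §3 Thm. B] -/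
theorem sum_ncard_fixedBy_mul_trace_inv_eq [IsPretransitive G T] {H : Subgroup G} [Fintype H]
    (hH : stabilizer G t₀ = H) {N : X ⟶ X} (hN : End.of N = ∑ h : H, ρ' h) (hℓ : (ℓ : K) ≠ 0) :
    ∑ g : G, ((fixedBy T g).ncard : ℤ_[ℓ]) * LinearMap.trace ℤ_[ℓ] (X.tateModule ℓ) (tateModuleMap ℓ (End.asHom (ρ' g⁻¹))) =
      ((Fintype.card G * (2 * (image N).dim) : ℕ) : ℤ_[ℓ]) := by
  classical
  -- `g ↦ χ_X(g⁻¹)` is a class function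
  have hcl : ∀ a g : G, LinearMap.trace ℤ_[ℓ] (X.tateModule ℓ) (tateModuleMap ℓ (End.asHom (ρ' (a * g * a⁻¹)⁻¹))) =
      LinearMap.trace ℤ_[ℓ] (X.tateModule ℓ) (tateModuleMap ℓ (End.asHom (ρ' g⁻¹))) := fun a g ↦ by
    rw [show (a * g * a⁻¹)⁻¹ = a * g⁻¹ * a⁻¹ by group]
    exact trace_tateModuleMap_asHom_conj ℓ ρ' a g⁻¹
  -- Frobenius reciprocity in counting form: `|G| Σ_{h ∈ H} χ_X(h⁻¹) = Σ_g m_H(g) χ_X(g⁻¹)`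
  have hFR := card_smul_sum_subgroup_eq_sum_card_conj_smul H
    (fun g ↦ LinearMap.trace ℤ_[ℓ] (X.tateModule ℓ) (tateModuleMap ℓ (End.asHom (ρ' g⁻¹)))) hcl
  -- `Σ_{h ∈ H} χ_X(h⁻¹) = Σ_{h ∈ H} χ_X(h)`
  have hinv : ∑ h : H, LinearMap.trace ℤ_[ℓ] (X.tateModule ℓ) (tateModuleMap ℓ (End.asHom (ρ' (h : G)⁻¹))) =
      ∑ h : H, LinearMap.trace ℤ_[ℓ] (X.tateModule ℓ) (tateModuleMap ℓ (End.asHom (ρ' h))) :=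
    Fintype.sum_equiv (Equiv.inv H) _ _ fun h ↦ by simp only [Equiv.inv_apply, Subgroup.coe_inv]
  have hFR' : ∑ g, (Nat.card {x : G // x⁻¹ * g * x ∈ H} : ℤ_[ℓ]) *
      LinearMap.trace ℤ_[ℓ] (X.tateModule ℓ) (tateModuleMap ℓ (End.asHom (ρ' g⁻¹))) =
      (Fintype.card G : ℤ_[ℓ]) * ∑ h : H, LinearMap.trace ℤ_[ℓ] (X.tateModule ℓ) (tateModuleMap ℓ (End.asHom (ρ' h))) := by
    rw [← hinv]
    simpa only [nsmul_eq_mul] using hFR.symm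
  -- `|H| Σ_g |T^g| χ_X(g⁻¹) = Σ_g m_H(g) χ_X(g⁻¹)`
  have hmarks : (Nat.card H : ℤ_[ℓ]) * ∑ g : G, ((fixedBy T g).ncard : ℤ_[ℓ]) *
      LinearMap.trace ℤ_[ℓ] (X.tateModule ℓ) (tateModuleMap ℓ (End.asHom (ρ' g⁻¹))) =
      ∑ g, (Nat.card {x : G // x⁻¹ * g * x ∈ H} : ℤ_[ℓ]) *
        LinearMap.trace ℤ_[ℓ] (X.tateModule ℓ) (tateModuleMap ℓ (End.asHom (ρ' g⁻¹))) := by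
    rw [Finset.mul_sum]
    refine Finset.sum_congr rfl fun g _ ↦ ?_
    rw [← mul_assoc, ← Nat.cast_mul, natCard_mul_ncard_fixedBy_eq_natCard_conj_mem t₀ hH g]
  have htr := card_mul_two_mul_dim_image_norm_eq_sum_trace_tateModuleMap ℓ ρ' hN hℓ
  have hH0 : (Nat.card H : ℤ_[ℓ]) ≠ 0 := by
    rw [Nat.card_eq_fintype_card]
    exact Nat.cast_ne_zero.2 Fintype.card_ne_zero
  apply mul_left_cancel₀ hH0
  rw [hmarks, hFR', ← htr, Nat.card_eq_fintype_card]
  push_cast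
  ring

/-- **`ℓ`-adic Frobenius reciprocity: `rk_{ℤ_ℓ} Hom_{ℤ_ℓ[G]}(T_ℓ X, T_ℓ A^T) = 4 · dim A · dim B_H(X)`** for a transitive `G`-set
`T ∋ t₀` with stabiliser `H` (`A^T = Ind_H^G A`), any action `ρ'` of the finite group `G` on `X` (`N_H = Σ_{h ∈ H} ρ'(h)`,
`B_H(X) = Im N_H`) and `ℓ` invertible in `K`: `|G| rk = Σ_g χ_{A^T}(g) χ_X(g⁻¹) = 2 dim A Σ_g |T^g| χ_X(g⁻¹) = |G| · 4 dim A dim B_H(X)`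
— "`Hom_G(V, Ind_H^G W) = Hom_H(Res V, W)`" with `dim Hom_H(T_ℓ X, T_ℓ A) = rk (T_ℓ X)_H · rk T_ℓ A`.  The Hom-side companion is
`rk_ℤ Hom_G(X, A^T) = rk_ℤ Hom(X, A)^H ≤ 4 dim B_H(X) dim A` (`Motives/AbelianVarietyPermutationPowerReciprocity`).
[cite: SerreLinearRepresentations1977, §7.2 Thm. 13 and Remark (1)] [cite: DokchitserEtAl2022, §3 and proof of Thm. 8.4]
[cite: MumfordAV1970, §19 Thm. 4 (p. 180)] -/
theorem finrank_equivariantTateHom_permPower_target_eq [IsPretransitive G T] (hb : ∑ t, b.π t ≫ b.ι t = 𝟙 b.pt)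
    (hρ : ∀ (g : G) (t : T), b.ι t ≫ End.asHom (ρ g) = b.ι (g • t)) {H : Subgroup G} [Fintype H]
    (hH : stabilizer G t₀ = H) {N : X ⟶ X} (hN : End.of N = ∑ h : H, ρ' h) (hℓ : (ℓ : K) ≠ 0) :
    Module.finrank ℤ_[ℓ]
        (⨅ g : G, LinearMap.eqLocus (LinearMap.llcomp ℤ_[ℓ] _ _ _ (tateModuleMap ℓ (End.asHom (ρ g))))
          (LinearMap.lcomp ℤ_[ℓ] _ (tateModuleMap ℓ (End.asHom (ρ' g)))) :
            Submodule ℤ_[ℓ] (X.tateModule ℓ →ₗ[ℤ_[ℓ]] b.pt.tateModule ℓ)) =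
      4 * A.dim * (image N).dim := by
  classical
  have h := card_mul_finrank_equivariantTateHom_eq_sum ℓ ρ' ρ hℓ
  simp_rw [trace_tateModuleMap_permAction_eq ℓ b ρ hb hρ hℓ] at h
  have hre : ∑ g : G, (((fixedBy T g).ncard * (2 * A.dim) : ℕ) : ℤ_[ℓ]) *
      LinearMap.trace ℤ_[ℓ] (X.tateModule ℓ) (tateModuleMap ℓ (End.asHom (ρ' g⁻¹))) =
      ((2 * A.dim : ℕ) : ℤ_[ℓ]) * ∑ g : G, ((fixedBy T g).ncard : ℤ_[ℓ]) *
        LinearMap.trace ℤ_[ℓ] (X.tateModule ℓ) (tateModuleMap ℓ (End.asHom (ρ' g⁻¹))) := by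
    rw [Finset.mul_sum]
    exact Finset.sum_congr rfl fun g _ ↦ by push_cast; ring
  rw [hre, sum_ncard_fixedBy_mul_trace_inv_eq ℓ ρ' t₀ hH hN hℓ] at h
  have h' : (Fintype.card G : ℤ_[ℓ]) * (Module.finrank ℤ_[ℓ]
      (⨅ g : G, LinearMap.eqLocus (LinearMap.llcomp ℤ_[ℓ] _ _ _ (tateModuleMap ℓ (End.asHom (ρ g))))
        (LinearMap.lcomp ℤ_[ℓ] _ (tateModuleMap ℓ (End.asHom (ρ' g)))) :
          Submodule ℤ_[ℓ] (X.tateModule ℓ →ₗ[ℤ_[ℓ]] b.pt.tateModule ℓ)) : ℤ_[ℓ]) =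
      (Fintype.card G : ℤ_[ℓ]) * ((4 * A.dim * (image N).dim : ℕ) : ℤ_[ℓ]) := by
    rw [h]
    push_cast
    ring
  exact_mod_cast mul_left_cancel₀ (Nat.cast_ne_zero.2 (Fintype.card_ne_zero (α := G))) h'

/-- The symmetric count **`rk_{ℤ_ℓ} Hom_{ℤ_ℓ[G]}(T_ℓ A^T, T_ℓ X) = 4 · dim A · dim B_H(X)`** (`rk Hom_{ℤ_ℓ[G]}(M, N) = rk Hom_{ℤ_ℓ[G]}(N, M)`,
`Motives/AbelianVarietyEquivariantTateHomSymmetry`): "`Hom_G(Ind W, V) = Hom_H(W, Res V)`". [cite: SerreLinearRepresentations1977, §7.2 Thm. 13 and Remark (1)]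
[cite: DokchitserEtAl2022, §3 and proof of Thm. 8.4] -/
theorem finrank_equivariantTateHom_permPower_source_eq [IsPretransitive G T] (hb : ∑ t, b.π t ≫ b.ι t = 𝟙 b.pt)
    (hρ : ∀ (g : G) (t : T), b.ι t ≫ End.asHom (ρ g) = b.ι (g • t)) {H : Subgroup G} [Fintype H]
    (hH : stabilizer G t₀ = H) {N : X ⟶ X} (hN : End.of N = ∑ h : H, ρ' h) (hℓ : (ℓ : K) ≠ 0) :
    Module.finrank ℤ_[ℓ]
        (⨅ g : G, LinearMap.eqLocus (LinearMap.llcomp ℤ_[ℓ] _ _ _ (tateModuleMap ℓ (End.asHom (ρ' g))))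
          (LinearMap.lcomp ℤ_[ℓ] _ (tateModuleMap ℓ (End.asHom (ρ g)))) :
            Submodule ℤ_[ℓ] (b.pt.tateModule ℓ →ₗ[ℤ_[ℓ]] X.tateModule ℓ)) =
      4 * A.dim * (image N).dim := by
  rw [finrank_equivariantTateHom_symm ℓ ρ ρ' hℓ]
  exact finrank_equivariantTateHom_permPower_target_eq ℓ b ρ ρ' t₀ hb hρ hH hN hℓ

omit [Fintype T] [Fintype G] [MulAction G T] in
/-- **The Hom-side Frobenius count is bounded by the `ℓ`-adic one: `rk_ℤ Hom_G(X, A^T) ≤ rk_{ℤ_ℓ} Hom_{ℤ_ℓ[G]}(T_ℓ X, T_ℓ A^T) =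
4 dim A dim B_H(X)`** (Mumford §19 Thm. 3 restricted to `Hom_G`, `Motives/AbelianVarietyEquivariantHomCharacterBound`); equality
would be Tate's conjecture for `(X, A)` with operators and is not asserted. [cite: MumfordAV1970, §19 Thm. 3 and Cor. 1 (pp. 176–178)]
[cite: SerreLinearRepresentations1977, §7.2 Thm. 13] -/
theorem finrank_equivariantHom_permPower_target_le_finrank_equivariantTateHom (hℓ : (ℓ : K) ≠ 0) :
    Module.finrank ℤ (⨅ g : G, LinearMap.eqLocus (Preadditive.leftComp b.pt (End.asHom (ρ' g))).toIntLinearMap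
        (Preadditive.rightComp X (End.asHom (ρ g))).toIntLinearMap : Submodule ℤ (X ⟶ b.pt)) ≤
      Module.finrank ℤ_[ℓ]
        (⨅ g : G, LinearMap.eqLocus (LinearMap.llcomp ℤ_[ℓ] _ _ _ (tateModuleMap ℓ (End.asHom (ρ g))))
          (LinearMap.lcomp ℤ_[ℓ] _ (tateModuleMap ℓ (End.asHom (ρ' g)))) :
            Submodule ℤ_[ℓ] (X.tateModule ℓ →ₗ[ℤ_[ℓ]] b.pt.tateModule ℓ)) :=
  finrank_equivariantHom_le ℓ ρ' ρ hℓ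

end Reciprocity

end AbelianVariety

end Literature.AlgebraicGeometry.Motives
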